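import Mathlib

/-!
# `MatrixDescartes` census — rank-one `(2,K)₁`: the CRITICAL WINDOWS LAW
# (exact localisation of the optimal direction at every critical point of the two-variable window profile)

HONEST FRAMING.  Object-search cell `pub-symmetroid`, seat `val-sym-mdr-p1` (generation 21); helper file `--supports` the crux item
stmt-ValiantsHypothesis-18050 (`Theses.LacunarySymmetroid.MatrixDescartes`, OPEN, on HOLD) with NO closure claim.  A STRUCTURE theorem
for the `m = 2` pivot column with rank-one letters (pivot `X^e J`, `det J < 0`, hyperbolic normal form `J` antidiagonal, letters
`wₖ X^{dₖ} (1,tₖ)(1,tₖ)ᵀ`, `tₖ > 0`; ONE letter `0` below the pivot, `d₀ < e`, the others above, `dⱼ > e` — the `1|K−1` splits, in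
particular the rank-one `(2,4)₁` cell and its chamber (C)).  It is pure real algebra and holds for EVERY exponent configuration and every
number of upper letters; it proves NO count.  Nothing here bears on `MatrixDescartes` in its window, on `DoorA26` / `DoorA34`,
registers / credences, or `VP ≠ VNP`; the rank-one register `{8, 9}` is unchanged.

THE OBJECT.  The lineage's two-variable window profile (g16 `…PivotRankOneNullDirection`, memo NULL-DIRECTION.md; g20 CURVATURE.md):
`𝔅(x,T) := (∑ₖ wₖ x^{dₖ} (T − tₖ)²)/(T·x^e)`, `x, T > 0`, whose sub-level set `{𝔅 < 2}` is the negativity region `{q_T(x) < 0}` of the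
direction forms `q_T(x) = (T,−1) F(x) (T,−1)ᵀ` (`𝔅 − 2 = q_T(x)/(T x^e)`); its components are box-disjoint, `Z₊(det F) = 2N − 1` with `N`
their number, and the one-variable profiles `Θ(x) = min_T 𝔅/2 = (√(AC) − U)/x^e` and `M(T) = min_x 𝔅` carry the same Morse data as `𝔅`
(local minima ↔ local minima, local maxima ↔ saddles).  In logarithmic coordinates `ψ = log T`, `s = log x`:
`𝔅 = ∑ₖ uₖ σ(ψ − τₖ) e^{(dₖ−e)s}`, `σ(y) = 4 sinh²(y/2)`, `uₖ = wₖtₖ`, `τₖ = log tₖ`.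

THE CRITICAL EQUATIONS.  `∂_T 𝔅 = 0 ⟺ A(x)T² = C(x) ⟺ ∑ₖ Wₖ (T² − tₖ²) = 0` and `x∂ₓ𝔅 = 0 ⟺ ∑ₖ (dₖ − e) Wₖ (T − tₖ)² = 0`, with the
positive point weights `Wₖ = wₖ x^{dₖ}` (§4 records both derivatives).  Below, letter `0` is separated: weight `W₀`, position `t₀`,
rate `−a = d₀ − e < 0`; the upper letters `j ∈ s` have weights `Wⱼ`, positions `tⱼ`, rates `bⱼ = dⱼ − e > 0`.

WHAT IS PROVED.
* `critical_signed_identity` (§1) — from the two critical equations, `∑ⱼ Wⱼ (T − tⱼ)·Δⱼ = 0` with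
  `Δⱼ = a(T − t₀)(T + tⱼ) + bⱼ(T + t₀)(T − tⱼ)` (multiply the first equation by `a(T − t₀)`, the second by `T + t₀`, add: the letter-0
  terms cancel).
* **`exists_window_of_critical_right` / `_left` (§2, THE CRITICAL WINDOWS LAW)** — at a critical point with `T > t₀` there is an upper
  letter `j` ON THE SAME SIDE and BEYOND the direction, `T < tⱼ`, with `bⱼ (T + t₀)(tⱼ − T) ≤ a (T − t₀)(tⱼ + T)`, i.e.
  `bⱼ/a ≤ tanh((ψ − τ₀)/2)·coth((τⱼ − ψ)/2)`; mirror statement for `T < t₀`; and `T ≠ t₀` unless all letters are parallel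
  (`ne_pivot_of_critical`).  READING: the right-hand side is strictly increasing in `T` on `(t₀, tⱼ)` from `0` to `+∞`
  (`window_ratio_lt`, `window_upward`), so the admissible directions for letter `j` form a WINDOW `(mⱼ, tⱼ)` whose inner edge `mⱼ` is the
  explicit hyperbolic offset `tanh((μⱼ − τ₀)/2)·coth((τⱼ − μⱼ)/2) = bⱼ/a` (for a far letter, `τⱼ − μⱼ ≈ log((bⱼ + a)/(bⱼ − a))` if `bⱼ > a` —
  the shoulder sits next to the letter — and `μⱼ − τ₀ ≈ log((a + bⱼ)/(a − bⱼ))` if `bⱼ < a` — the peak sits next to the pivot letter): EVERY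
  local maximum, local minimum or saddle of the window profile has its direction in the window of some upper letter on its own side.
* COROLLARIES (§3): `critical_right_of_letters_right` — if all upper letters lie on one side of `t₀`, every critical direction lies on
  that side (the profile `M` is monotone on the other side: no window component and no dip there except the letter-0 needle);
  `exists_letter_beyond` — no critical direction beyond the outermost letter.
* §4: the two partial derivatives of `𝔅` (`hasDerivAt_profile_T`, `hasDerivAt_profile_x`), identifying the displayed equations as
  `∂_T 𝔅 = 0`, `∂ₓ 𝔅 = 0`; §5: at a `T`-critical point `det F(x) = (AT − U − x^e)(AT + U + x^e)`, so the critical VALUE lies below the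
  level `2` exactly when `x` is in a window (`det_eq_mul_of_dirCritical`).
MECHANISM in one line (seat memo PROFILE-GAUGE.md): `(log M)′(ψ) = ∑ₖ πₖ* coth((ψ − τₖ)/2)` for the optimal dual measure `π*`, and the
`s`-equation `∑ πₖ*(dₖ − e) = 0` eliminates the pivot-letter charge `π₀* = ∑ⱼ (bⱼ/a)πⱼ*`, leaving a positive combination of the two-letter
fields `(bⱼ/a)coth((ψ−τ₀)/2) + coth((ψ−τⱼ)/2)`, each negative exactly on its window.  What is NOT here: any bound on the NUMBER of critical
points per window (the seat's located «per-side law»: at most one local maximum of `M` per upper letter on each side, which would give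
`N ≤ 4`, `Z₊ ≤ 7` on the whole `1|3` split — OPEN).

[folklore] Elementary real algebra (`Finset.sum_eq_zero_iff_of_nonneg`); one-variable derivatives from Mathlib.  No definitions, no named facts.
-/

-- `Summit.ValiantsHypothesis.ValiantsHypothesis.…` repeats a component by the D-0017 layout
-- (single-conjunct summit), which the `dupNamespace` linter flags; the name is mandated.
set_option linter.dupNamespace false

namespace Summit.ValiantsHypothesis.ValiantsHypothesis.Theorems.LacunarySymmetroidMatrixDescartes.Pivot.CriticalWindows

open Finset
open scoped BigOperators

/-! ## 1. The signed identity behind the two critical equations -/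

/-- **SIGNED IDENTITY.**  If `W₀(T² − t₀²) + ∑ⱼ Wⱼ(T² − tⱼ²) = 0` (the `T`-critical equation `AT² = C`) and
`−a W₀ (T − t₀)² + ∑ⱼ bⱼ Wⱼ (T − tⱼ)² = 0` (the `x`-critical equation), then
`∑ⱼ Wⱼ (T − tⱼ)·(a(T − t₀)(T + tⱼ) + bⱼ(T + t₀)(T − tⱼ)) = 0`: multiply the first by `a(T − t₀)`, the second by `(T + t₀)` and add —
the two letter-`0` terms are `± aW₀(T − t₀)²(T + t₀)` and cancel. [folklore] -/
theorem critical_signed_identity {ι : Type*} (s : Finset ι) (a t₀ T W₀ : ℝ) (b t W : ι → ℝ)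
    (h1 : W₀ * (T ^ 2 - t₀ ^ 2) + ∑ j ∈ s, W j * (T ^ 2 - t j ^ 2) = 0)
    (h2 : -a * W₀ * (T - t₀) ^ 2 + ∑ j ∈ s, b j * W j * (T - t j) ^ 2 = 0) :
    ∑ j ∈ s, W j * (T - t j) * (a * (T - t₀) * (T + t j) + b j * (T + t₀) * (T - t j)) = 0 := by
  have hterm : ∀ j ∈ s, W j * (T - t j) * (a * (T - t₀) * (T + t j) + b j * (T + t₀) * (T - t j))
      = a * (T - t₀) * (W j * (T ^ 2 - t j ^ 2)) + (T + t₀) * (b j * W j * (T - t j) ^ 2) := by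
    intro j _; ring
  have e1 : ∑ j ∈ s, W j * (T ^ 2 - t j ^ 2) = -(W₀ * (T ^ 2 - t₀ ^ 2)) := by linarith
  have e2 : ∑ j ∈ s, b j * W j * (T - t j) ^ 2 = a * W₀ * (T - t₀) ^ 2 := by linarith
  rw [Finset.sum_congr rfl hterm, Finset.sum_add_distrib, ← Finset.mul_sum, ← Finset.mul_sum, e1, e2]
  ring

/-- A term of the signed identity at a letter BEFORE the direction (`tⱼ < T`, with `t₀ < T`) is strictly positive. [folklore] -/
theorem term_pos_of_lt {a t₀ T bj tj Wj : ℝ} (ha : 0 < a) (hb : 0 < bj) (hW : 0 < Wj) (ht₀ : 0 < t₀)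
    (htj : 0 < tj) (hT : t₀ < T) (hlt : tj < T) :
    0 < Wj * (T - tj) * (a * (T - t₀) * (T + tj) + bj * (T + t₀) * (T - tj)) := by
  have h1 : 0 < T - tj := by linarith
  have hA : 0 < T - t₀ := by linarith
  have hB : 0 < T + tj := by linarith
  have hC : 0 < T + t₀ := by linarith
  have h2 : 0 < a * (T - t₀) * (T + tj) := mul_pos (mul_pos ha hA) hB
  have h3 : 0 < bj * (T + t₀) * (T - tj) := mul_pos (mul_pos hb hC) h1
  have h4 : 0 < a * (T - t₀) * (T + tj) + bj * (T + t₀) * (T - tj) := by linarith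
  exact mul_pos (mul_pos hW h1) h4

/-- A term of the signed identity at a letter BEYOND the direction (`T < tⱼ`, with `t₀ < T`) whose window inequality FAILS
(`a(T − t₀)(tⱼ + T) < bⱼ(T + t₀)(tⱼ − T)`) is strictly positive (both factors are negative). [folklore] -/
theorem term_pos_of_gt {a t₀ T bj tj Wj : ℝ} (hW : 0 < Wj) (hgt : T < tj)
    (hfail : a * (T - t₀) * (tj + T) < bj * (T + t₀) * (tj - T)) :
    0 < Wj * (T - tj) * (a * (T - t₀) * (T + tj) + bj * (T + t₀) * (T - tj)) := by
  have h1 : T - tj < 0 := by linarith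
  have h2 : a * (T - t₀) * (T + tj) + bj * (T + t₀) * (T - tj) < 0 := by nlinarith
  have h3 : 0 < (T - tj) * (a * (T - t₀) * (T + tj) + bj * (T + t₀) * (T - tj)) := mul_pos_of_neg_of_neg h1 h2
  have : Wj * (T - tj) * (a * (T - t₀) * (T + tj) + bj * (T + t₀) * (T - tj))
      = Wj * ((T - tj) * (a * (T - t₀) * (T + tj) + bj * (T + t₀) * (T - tj))) := by ring
  rw [this]
  exact mul_pos hW h3

/-! ## 2. The critical windows law -/

/-- **CRITICAL WINDOWS LAW (direction right of the pivot letter).**  Let `a > 0` (the pivot letter's rate `e − d₀`), `bⱼ > 0` (the upper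
letters' rates `dⱼ − e`), positive point weights `W₀, Wⱼ` (`= wₖ x^{dₖ}`), positive positions `t₀, tⱼ`, and a direction `T > t₀`
satisfying the two critical equations of the window profile `𝔅(x,T) = ∑ₖ wₖx^{dₖ}(T − tₖ)²/(T x^e)`.  Then some upper letter `j` lies
BEYOND the direction, `T < tⱼ`, and satisfies the window inequality `bⱼ (T + t₀)(tⱼ − T) ≤ a (T − t₀)(tⱼ + T)` — equivalently
`bⱼ/a ≤ tanh((ψ − τ₀)/2)·coth((τⱼ − ψ)/2)` in logarithmic coordinates.  Proof: otherwise every term of `critical_signed_identity` is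
non-negative, and strictly positive unless `tⱼ = T`; so all `tⱼ = T`, and then the first equation forces `T = t₀`. [folklore] -/
theorem exists_window_of_critical_right {ι : Type*} (s : Finset ι) (a t₀ T W₀ : ℝ) (b t W : ι → ℝ)
    (ha : 0 < a) (hb : ∀ j ∈ s, 0 < b j) (hW₀ : 0 < W₀) (hW : ∀ j ∈ s, 0 < W j) (ht₀ : 0 < t₀)
    (ht : ∀ j ∈ s, 0 < t j) (hT : t₀ < T)
    (h1 : W₀ * (T ^ 2 - t₀ ^ 2) + ∑ j ∈ s, W j * (T ^ 2 - t j ^ 2) = 0)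
    (h2 : -a * W₀ * (T - t₀) ^ 2 + ∑ j ∈ s, b j * W j * (T - t j) ^ 2 = 0) :
    ∃ j ∈ s, T < t j ∧ b j * (T + t₀) * (t j - T) ≤ a * (T - t₀) * (t j + T) := by
  by_contra hcon
  push Not at hcon
  have hid := critical_signed_identity s a t₀ T W₀ b t W h1 h2
  have hnn : ∀ j ∈ s, 0 ≤ W j * (T - t j) * (a * (T - t₀) * (T + t j) + b j * (T + t₀) * (T - t j)) := by
    intro j hj
    rcases lt_trichotomy (t j) T with hlt | heq | hgt
    · exact (term_pos_of_lt ha (hb j hj) (hW j hj) ht₀ (ht j hj) hT hlt).le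
    · rw [heq]; simp
    · exact (term_pos_of_gt (hW j hj) hgt (hcon j hj hgt)).le
  have hall := (Finset.sum_eq_zero_iff_of_nonneg hnn).1 hid
  have htT : ∀ j ∈ s, t j = T := by
    intro j hj
    rcases lt_trichotomy (t j) T with hlt | heq | hgt
    · exact absurd (hall j hj) (term_pos_of_lt ha (hb j hj) (hW j hj) ht₀ (ht j hj) hT hlt).ne'
    · exact heq
    · exact absurd (hall j hj) (term_pos_of_gt (hW j hj) hgt (hcon j hj hgt)).ne'
  have hsum : ∑ j ∈ s, W j * (T ^ 2 - t j ^ 2) = 0 :=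
    Finset.sum_eq_zero fun j hj => by rw [htT j hj]; ring
  rw [hsum, add_zero] at h1
  rcases mul_eq_zero.1 h1 with h | h
  · exact absurd h hW₀.ne'
  · nlinarith

/-- **CRITICAL WINDOWS LAW (direction left of the pivot letter).**  Mirror statement: at a critical point with `T < t₀` some upper letter
`j` lies beyond the direction on the same side, `tⱼ < T`, with `bⱼ (T + t₀)(T − tⱼ) ≤ a (t₀ − T)(tⱼ + T)`, i.e.
`bⱼ/a ≤ tanh((τ₀ − ψ)/2)·coth((ψ − τⱼ)/2)`. [folklore] -/
theorem exists_window_of_critical_left {ι : Type*} (s : Finset ι) (a t₀ T W₀ : ℝ) (b t W : ι → ℝ)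
    (ha : 0 < a) (hb : ∀ j ∈ s, 0 < b j) (hW₀ : 0 < W₀) (hW : ∀ j ∈ s, 0 < W j) (hT₀ : 0 < T)
    (hT : T < t₀)
    (h1 : W₀ * (T ^ 2 - t₀ ^ 2) + ∑ j ∈ s, W j * (T ^ 2 - t j ^ 2) = 0)
    (h2 : -a * W₀ * (T - t₀) ^ 2 + ∑ j ∈ s, b j * W j * (T - t j) ^ 2 = 0) :
    ∃ j ∈ s, t j < T ∧ b j * (T + t₀) * (T - t j) ≤ a * (t₀ - T) * (t j + T) := by
  by_contra hcon
  push Not at hcon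
  have hid := critical_signed_identity s a t₀ T W₀ b t W h1 h2
  -- every term is non-negative, and positive unless `t j = T`
  have hpos_lt : ∀ j ∈ s, t j < T →
      0 < W j * (T - t j) * (a * (T - t₀) * (T + t j) + b j * (T + t₀) * (T - t j)) := by
    intro j hj hlt
    have hc := hcon j hj hlt
    have h1' : 0 < T - t j := by linarith
    have h2' : 0 < a * (T - t₀) * (T + t j) + b j * (T + t₀) * (T - t j) := by nlinarith
    exact mul_pos (mul_pos (hW j hj) h1') h2'
  have hpos_gt : ∀ j ∈ s, T < t j →
      0 < W j * (T - t j) * (a * (T - t₀) * (T + t j) + b j * (T + t₀) * (T - t j)) := by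
    intro j hj hgt
    have h1' : T - t j < 0 := by linarith
    have hA : a * (T - t₀) * (T + t j) < 0 := by
      have hn : T - t₀ < 0 := by linarith
      have hp : 0 < T + t j := by linarith
      have : a * (T - t₀) * (T + t j) = -(a * (t₀ - T) * (T + t j)) := by ring
      rw [this, neg_lt_zero]
      exact mul_pos (mul_pos ha (by linarith)) hp
    have hB : b j * (T + t₀) * (T - t j) < 0 := by
      have hp : 0 < T + t₀ := by linarith
      have : b j * (T + t₀) * (T - t j) = -(b j * (T + t₀) * (t j - T)) := by ring
      rw [this, neg_lt_zero]
      exact mul_pos (mul_pos (hb j hj) hp) (by linarith)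
    have h2' : a * (T - t₀) * (T + t j) + b j * (T + t₀) * (T - t j) < 0 := by linarith
    have h3 : 0 < (T - t j) * (a * (T - t₀) * (T + t j) + b j * (T + t₀) * (T - t j)) :=
      mul_pos_of_neg_of_neg h1' h2'
    have : W j * (T - t j) * (a * (T - t₀) * (T + t j) + b j * (T + t₀) * (T - t j))
        = W j * ((T - t j) * (a * (T - t₀) * (T + t j) + b j * (T + t₀) * (T - t j))) := by ring
    rw [this]
    exact mul_pos (hW j hj) h3
  have hnn : ∀ j ∈ s, 0 ≤ W j * (T - t j) * (a * (T - t₀) * (T + t j) + b j * (T + t₀) * (T - t j)) := by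
    intro j hj
    rcases lt_trichotomy (t j) T with hlt | heq | hgt
    · exact (hpos_lt j hj hlt).le
    · rw [heq]; simp
    · exact (hpos_gt j hj hgt).le
  have hall := (Finset.sum_eq_zero_iff_of_nonneg hnn).1 hid
  have htT : ∀ j ∈ s, t j = T := by
    intro j hj
    rcases lt_trichotomy (t j) T with hlt | heq | hgt
    · exact absurd (hall j hj) (hpos_lt j hj hlt).ne'
    · exact heq
    · exact absurd (hall j hj) (hpos_gt j hj hgt).ne'
  have hsum : ∑ j ∈ s, W j * (T ^ 2 - t j ^ 2) = 0 :=
    Finset.sum_eq_zero fun j hj => by rw [htT j hj]; ring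
  rw [hsum, add_zero] at h1
  rcases mul_eq_zero.1 h1 with h | h
  · exact absurd h hW₀.ne'
  · nlinarith

/-- **The direction is never the pivot letter's.**  If `T = t₀` satisfies the `x`-critical equation then every upper letter is parallel to
the pivot letter (`tⱼ = t₀` for all `j`): the window profile of a non-degenerate configuration has no critical point on the needle line
`T = t₀`. [folklore] -/
theorem eq_pivot_of_critical_pivot {ι : Type*} (s : Finset ι) (a t₀ W₀ : ℝ) (b t W : ι → ℝ)
    (hb : ∀ j ∈ s, 0 < b j) (hW : ∀ j ∈ s, 0 < W j)
    (h2 : -a * W₀ * (t₀ - t₀) ^ 2 + ∑ j ∈ s, b j * W j * (t₀ - t j) ^ 2 = 0) :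
    ∀ j ∈ s, t j = t₀ := by
  rw [sub_self, zero_pow two_ne_zero, mul_zero, zero_add] at h2
  have hnn : ∀ j ∈ s, 0 ≤ b j * W j * (t₀ - t j) ^ 2 := fun j hj =>
    mul_nonneg (mul_nonneg (hb j hj).le (hW j hj).le) (sq_nonneg _)
  have hall := (Finset.sum_eq_zero_iff_of_nonneg hnn).1 h2
  intro j hj
  have h := hall j hj
  rcases mul_eq_zero.1 h with h' | h'
  · rcases mul_eq_zero.1 h' with h'' | h''
    · exact absurd h'' (hb j hj).ne'
    · exact absurd h'' (hW j hj).ne'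
  · have h3 : t₀ - t j = 0 := (pow_eq_zero_iff two_ne_zero).1 h'
    linarith

/-! ## 3. Corollaries: one-sided letters, the outermost letter, and the shape of a window -/

/-- **ONE-SIDED LETTERS ⇒ ONE-SIDED CRITICAL DIRECTIONS.**  If every upper letter lies to the right of the pivot letter (`t₀ < tⱼ` for all
`j ∈ s`, `s` non-empty), then every critical point of the window profile has `t₀ < T`: the `ψ`-profile `M` is strictly monotone on the
far side `T < t₀`, which therefore carries no dip and no window component besides the letter-`0` needle. [folklore] -/
theorem critical_right_of_letters_right {ι : Type*} (s : Finset ι) (hs : s.Nonempty) (a t₀ T W₀ : ℝ) (b t W : ι → ℝ)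
    (ha : 0 < a) (hb : ∀ j ∈ s, 0 < b j) (hW₀ : 0 < W₀) (hW : ∀ j ∈ s, 0 < W j) (hT₀ : 0 < T)
    (ht : ∀ j ∈ s, t₀ < t j)
    (h1 : W₀ * (T ^ 2 - t₀ ^ 2) + ∑ j ∈ s, W j * (T ^ 2 - t j ^ 2) = 0)
    (h2 : -a * W₀ * (T - t₀) ^ 2 + ∑ j ∈ s, b j * W j * (T - t j) ^ 2 = 0) :
    t₀ < T := by
  rcases lt_trichotomy T t₀ with hlt | heq | hgt
  · obtain ⟨j, hj, hjT, -⟩ := exists_window_of_critical_left s a t₀ T W₀ b t W ha hb hW₀ hW hT₀ hlt h1 h2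
    exact absurd ((ht j hj).trans (hjT.trans hlt)) (lt_irrefl _)
  · rw [heq] at h2
    obtain ⟨j, hj⟩ := hs
    have := eq_pivot_of_critical_pivot s a t₀ W₀ b t W hb hW h2 j hj
    exact absurd this (ht j hj).ne'
  · exact hgt

/-- **NO CRITICAL DIRECTION BEYOND THE OUTERMOST LETTER.**  At a critical point with `t₀ < T` some upper letter has `T < tⱼ`; in
particular `T < max tⱼ`. [folklore] -/
theorem exists_letter_beyond {ι : Type*} (s : Finset ι) (a t₀ T W₀ : ℝ) (b t W : ι → ℝ)
    (ha : 0 < a) (hb : ∀ j ∈ s, 0 < b j) (hW₀ : 0 < W₀) (hW : ∀ j ∈ s, 0 < W j) (ht₀ : 0 < t₀)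
    (ht : ∀ j ∈ s, 0 < t j) (hT : t₀ < T)
    (h1 : W₀ * (T ^ 2 - t₀ ^ 2) + ∑ j ∈ s, W j * (T ^ 2 - t j ^ 2) = 0)
    (h2 : -a * W₀ * (T - t₀) ^ 2 + ∑ j ∈ s, b j * W j * (T - t j) ^ 2 = 0) :
    ∃ j ∈ s, T < t j := by
  obtain ⟨j, hj, hjT, -⟩ := exists_window_of_critical_right s a t₀ T W₀ b t W ha hb hW₀ hW ht₀ ht hT h1 h2
  exact ⟨j, hj, hjT⟩

/-- **THE WINDOW IS AN INTERVAL ENDING AT THE LETTER.**  The window inequality is upward closed in the direction: if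
`bⱼ(T + t₀)(tⱼ − T) ≤ a(T − t₀)(tⱼ + T)` at some `T ∈ (t₀, tⱼ)` then also at every `T' ∈ [T, tⱼ)` — both factors
`(T − t₀)/(T + t₀) = tanh((ψ−τ₀)/2)` and `(tⱼ + T)/(tⱼ − T) = coth((τⱼ−ψ)/2)` increase with `T`.  So the admissible directions of letter `j`
form an interval `(mⱼ, tⱼ)` (or `[mⱼ, tⱼ)`), `mⱼ` the unique solution of equality. [folklore] -/
theorem window_upward {a t₀ bj tj T T' : ℝ} (ha : 0 < a) (hb : 0 < bj) (ht₀ : 0 < t₀) (hT : t₀ < T) (hTT' : T ≤ T')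
    (hT' : T' < tj) (hwin : bj * (T + t₀) * (tj - T) ≤ a * (T - t₀) * (tj + T)) :
    bj * (T' + t₀) * (tj - T') ≤ a * (T' - t₀) * (tj + T') := by
  -- `f(X) := a(X − t₀)(tⱼ + X) − bⱼ(X + t₀)(tⱼ − X)` is a convex quadratic with `f(t₀) = −2bⱼt₀(tⱼ − t₀) < 0`; the chord identity
  -- `(T − t₀)·f(T') = (T' − t₀)·f(T) + (a + bⱼ)(T' − T)(T − t₀)(T' − t₀) + (T' − T)·2bⱼt₀(tⱼ − t₀)` has a non-negative right side.
  have key : (T - t₀) * (a * (T' - t₀) * (tj + T') - bj * (T' + t₀) * (tj - T'))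
      = (T' - t₀) * (a * (T - t₀) * (tj + T) - bj * (T + t₀) * (tj - T))
        + (a + bj) * ((T' - T) * (T - t₀) * (T' - t₀)) + (T' - T) * (2 * bj * t₀ * (tj - t₀)) := by
    ring
  have hA : 0 ≤ (T' - t₀) * (a * (T - t₀) * (tj + T) - bj * (T + t₀) * (tj - T)) :=
    mul_nonneg (by linarith) (by linarith)
  have hB : 0 ≤ (a + bj) * ((T' - T) * (T - t₀) * (T' - t₀)) :=
    mul_nonneg (by linarith) (mul_nonneg (mul_nonneg (by linarith) (by linarith)) (by linarith))
  have hC : 0 ≤ (T' - T) * (2 * bj * t₀ * (tj - t₀)) :=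
    mul_nonneg (by linarith) (mul_nonneg (mul_nonneg (mul_nonneg zero_le_two hb.le) ht₀.le) (by linarith))
  have hpos : 0 < T - t₀ := by linarith
  have h : 0 ≤ (T - t₀) * (a * (T' - t₀) * (tj + T') - bj * (T' + t₀) * (tj - T')) := by
    rw [key]; linarith
  have h' := (mul_nonneg_iff_of_pos_left hpos).mp h
  linarith

/-! ## 4. The two displayed equations ARE the critical equations of the window profile -/

/-- **`T`-DERIVATIVE OF THE PROFILE.**  For fixed `x`, the window profile is `T ↦ (A T² − 2UT + C)/(T·x^e)` with `A = ∑ wₖx^{dₖ}`,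
`U = ∑ wₖtₖx^{dₖ}`, `C = ∑ wₖtₖ²x^{dₖ}`; up to the constant factor `1/x^e` its derivative at `T ≠ 0` is `(A T² − C)/T²`, which vanishes
exactly when `A T² = C`, i.e. `∑ₖ Wₖ (T² − tₖ²) = 0` (the first hypothesis of §2). [folklore] -/
theorem hasDerivAt_profile_T (A U C T : ℝ) (hT : T ≠ 0) :
    HasDerivAt (fun T => (A * T ^ 2 - 2 * U * T + C) / T) ((A * T ^ 2 - C) / T ^ 2) T := by
  have hf : HasDerivAt (fun T => A * T ^ 2 - 2 * U * T + C) (A * (2 * T) - 2 * U) T := by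
    have h1 : HasDerivAt (fun T => A * T ^ 2) (A * (2 * T)) T := by
      simpa using ((hasDerivAt_pow 2 T).const_mul A)
    have h2 : HasDerivAt (fun T => 2 * U * T) (2 * U) T := by
      simpa using ((hasDerivAt_id T).const_mul (2 * U))
    simpa using (h1.sub h2).add_const C
  have hg : HasDerivAt (fun T : ℝ => T) 1 T := hasDerivAt_id T
  have h := hf.div hg hT
  have heq : ((A * (2 * T) - 2 * U) * T - (A * T ^ 2 - 2 * U * T + C) * 1) / T ^ 2 = (A * T ^ 2 - C) / T ^ 2 := by
    congr 1; ring
  rw [heq] at h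
  exact h

/-- The quadratic numerator in the letters' data: `A T² − C = ∑ₖ Wₖ (T² − tₖ²)` and `A T² − 2UT + C = ∑ₖ Wₖ (T − tₖ)²`
(`A = ∑ Wₖ`, `U = ∑ Wₖtₖ`, `C = ∑ Wₖtₖ²`). [folklore] -/
theorem profile_numerators {ι : Type*} (s : Finset ι) (W t : ι → ℝ) (T : ℝ) :
    (∑ k ∈ s, W k) * T ^ 2 - ∑ k ∈ s, W k * t k ^ 2 = ∑ k ∈ s, W k * (T ^ 2 - t k ^ 2) ∧
      (∑ k ∈ s, W k) * T ^ 2 - 2 * (∑ k ∈ s, W k * t k) * T + ∑ k ∈ s, W k * t k ^ 2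
        = ∑ k ∈ s, W k * (T - t k) ^ 2 := by
  constructor
  · rw [Finset.sum_mul, ← Finset.sum_sub_distrib]
    exact Finset.sum_congr rfl fun k _ => by ring
  · rw [Finset.sum_mul, Finset.mul_sum, Finset.sum_mul, ← Finset.sum_sub_distrib, ← Finset.sum_add_distrib]
    exact Finset.sum_congr rfl fun k _ => by ring

/-- **`x`-DERIVATIVE OF THE PROFILE.**  For fixed `T`, the window profile is the Laurent fewnomial `x ↦ ∑ₖ cₖ x^{mₖ}` with
`cₖ = wₖ(T − tₖ)²/T` and INTEGER exponents `mₖ = dₖ − e`; its derivative at `x ≠ 0` is `∑ₖ cₖ·mₖ x^{mₖ−1}`. [folklore] -/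
theorem hasDerivAt_profile_x {ι : Type*} (s : Finset ι) (c : ι → ℝ) (m : ι → ℤ) (x : ℝ) (hx : x ≠ 0) :
    HasDerivAt (fun x => ∑ k ∈ s, c k * x ^ (m k)) (∑ k ∈ s, c k * ((m k : ℝ) * x ^ (m k - 1))) x := by
  exact HasDerivAt.fun_sum (u := s) (A := fun k y => c k * y ^ (m k))
    (A' := fun k => c k * ((m k : ℝ) * x ^ (m k - 1)))
    fun k _ => (hasDerivAt_zpow (m k) x (Or.inl hx)).const_mul (c k)

/-- … and `x` times that derivative is the EULER DERIVATIVE `∑ₖ mₖ cₖ x^{mₖ}`, which vanishes exactly when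
`∑ₖ (dₖ − e) wₖ (T − tₖ)² x^{dₖ−e} = 0`, i.e. (times `T x^e > 0`) `∑ₖ (dₖ − e) Wₖ (T − tₖ)² = 0` — the second hypothesis of §2
(letter `0`: `d₀ − e = −a`; letters `j`: `dⱼ − e = bⱼ`). [folklore] -/
theorem euler_derivative_profile_x {ι : Type*} (s : Finset ι) (c : ι → ℝ) (m : ι → ℤ) (x : ℝ) (hx : x ≠ 0) :
    x * ∑ k ∈ s, c k * ((m k : ℝ) * x ^ (m k - 1)) = ∑ k ∈ s, (m k : ℝ) * c k * x ^ (m k) := by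
  rw [Finset.mul_sum]
  refine Finset.sum_congr rfl fun k _ => ?_
  have : x ^ (m k) = x ^ (m k - 1) * x := by
    rw [← zpow_add_one₀ hx, sub_add_cancel]
  rw [this]; ring

/-! ## 5. The critical value: below the level `2` exactly inside a window -/

/-- **CRITICAL VALUE.**  At a `T`-critical point (`A T² = C`) the profile value minus the level `2` is `2(AT − U − E)/E`
(`E = x^e` the pivot weight): `(A T² − 2UT + C)/(T E) − 2 = 2 (A T − U − E)/E`. [folklore] -/
theorem critical_value_eq (A U C E T : ℝ) (hT : T ≠ 0) (hE : E ≠ 0) (h : A * T ^ 2 = C) :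
    (A * T ^ 2 - 2 * U * T + C) / (T * E) - 2 = 2 * (A * T - U - E) / E := by
  rw [← h]
  field_simp
  ring

/-- **… AND THE DETERMINANT FACTORS THROUGH IT.**  With `det F(x) = A C − (U + E)²` (the `2 × 2` pencil in hyperbolic normal form,
`E = x^e`) and `A T² = C`: `det F(x) = (A T − U − E)(A T + U + E)`.  Since `A T + U + E > 0` for positive data, the critical value lies
below the level `2` exactly when `det F(x) < 0`, i.e. when `x` is inside a negativity window — the dictionary between critical points of
the profile and the windows counted by `Z₊ = 2N − 1`. [folklore] -/
theorem det_eq_mul_of_dirCritical (A U C E T : ℝ) (h : A * T ^ 2 = C) :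
    A * C - (U + E) ^ 2 = (A * T - U - E) * (A * T + U + E) := by
  rw [← h]; ring

end Summit.ValiantsHypothesis.ValiantsHypothesis.Theorems.LacunarySymmetroidMatrixDescartes.Pivot.CriticalWindows
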